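import Mathlib
import Summits.Ventures.PercRepro2.SwOutSevDefs
import Summits.Ventures.PercRepro2.SwOutSevPieces
import Summits.Ventures.PercRepro2.SwOutSevData
import Summits.Ventures.PercRepro2.SwOutSevConn

/-!
# The canonical base of a core-kind point of a several-arms junction is a several-arms base
(blind cell PercRepro2, night-4 g22, 2026-08-27; proofs/NIGHT4-G22.md §2)

For a core-kind `Q`-point `ζ` of a class with a several-arms junction (`MixedJunctionR`), the
canonical base `b = coreBaseOf ζ` is a **`MixedBaseR`** on the data read off `ζ` (`mixedDataR`):
the u-arms of `ζ` TOGETHER WITH THE ABSORBED ARMS (the arms of the dropped vertices with a red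
dead edge at `b`, each re-typed as a u-arm — red-connected to `h` through its red dead edge and
the red h-edge of its end), the MIXED arms (every dead edge blue at `b`) with their pieces, and
the far arms (**`mixedBaseR_of_coreKindR`**).  The single-arm dichotomy of Theorem A_mix (a
`MixedBase` or a `CoreBase`) is the case `ρ = Unit`: both kinds are now one block theorem.
Every field is a structural lemma of the (H1) files, of `SwOutSevDefs`, `SwOutSevPieces`,
`SwOutSevData` or `SwOutSevConn` (the connectivity fields).
-/

namespace Summit.Ventures.PercRepro2

namespace MixedArms

open Hull LocRows BigBlock

variable {V : Type*} {E : Type*} [Fintype E] [DecidableEq E]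

open scoped Classical

variable {ends : E → Sym2 V} {ρ : Type*} [Fintype ρ] {U : Set V} {ξ : Config E} {l h o u : V}
  {p : ρ → V}

section Base

variable (hj : MixedJunctionR ends U h u p o)
include hj

/-- **The canonical base of a core-kind `Q`-point is a several-arms base** on the data read off
the point: the u-arms with the absorbed arms, the mixed arms with their pieces, the far arms. -/
theorem mixedBaseR_of_coreKindR (hl : l ∉ U) {ζ : Config E} (hζ : ζ ∈ swOutSide ends l h o U ξ)
    (hk : CoreKind ends U h u ζ) :
    MixedBaseR ends (coreBaseOf ends ζ h u) h u (mixedDataR ends h u p ζ).U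
      ((mixedDataR ends h u p ζ).drop p) (mixedDataR ends h u p ζ).Ah
      (mixedDataR ends h u p ζ).arm (mixedDataR ends h u p ζ).F := by
  have hhu := hj.hne_hu
  have hdisj : ∀ x, x ∈ redExt ends h u ζ → x ∈ blueExt ends ζ h u → False :=
    fun x hxR hxB => redExt_disjoint_blueExt hl hj.hout hζ hk x hxR hxB
  have hnoRB : ∀ e x y, ends e = s(x, y) → x ∈ redExt ends h u ζ → y ∈ blueExt ends ζ h u →
      False := fun e x y hxy hx hy => no_edge_redExt_blueExt hdisj hxy hx hy
  have hHU : extHull ends ζ h u ⊆ U := extHull_subset_of_coreKind hζ hk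
  have hdisj' : ∀ x, x ∈ redExt ends h u (blue ζ) → x ∈ blueExt ends (blue ζ) h u → False := by
    intro x hxR hxB
    rw [redExt_blue] at hxR
    rw [blueExt_blue] at hxB
    exact hdisj x hxB hxR
  have hAP : ∀ r, armC ends h u ζ (p r) ∈ armsC ends h u ζ := armP_mem_armsC_R hj ζ
  have hpH : ∀ r, p r ∈ extHull ends ζ h u := fun r => p_mem_extHull (hj.hup r) ζ
  have hpP : ∀ r, p r ∈ armC ends h u ζ (p r) := fun r => mem_armC_self (p r)
  have hph : ∀ r, p r ≠ h := fun r => (hj.hne_hp r).symm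
  have hpu : ∀ r, p r ≠ u := fun r => (hj.hne_up r).symm
  -- the index types
  set d := mixedDataR ends h u p ζ with hd
  -- every u-arm set of the data is an arm
  have hUmem : ∀ j : d.ι, d.U j ∈ armsC ends h u ζ := by
    rintro (⟨P, hP⟩ | ⟨x, hx⟩)
    · exact (mem_uArmsR_iff.1 hP).1
    · obtain ⟨-, hx2⟩ := mem_absArmsR_iff.1 hx
      show x.2 ∈ armsC ends h u ζ
      rw [hx2]; exact hAP x.1
  -- an absorbed arm set
  have hAbs : ∀ x : {x // x ∈ d.abs}, d.U (Sum.inr x) = armC ends h u ζ (p x.1.1) ∧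
      ¬ DeadBlueR ends h u p ζ x.1.1 := by
    intro x
    obtain ⟨hx1, hx2⟩ := mem_absArmsR_iff.1 x.2
    exact ⟨hx2, hx1⟩
  -- a piece
  have hPc : ∀ i : d.ν, DeadBlueR ends h u p ζ i.1.1 ∧
      ∃ y ∈ AhOfR ends h u p ζ i.1.1, d.Ah i = pieceC ends h u p ζ i.1.1 y := by
    intro i
    exact exists_pieceC_of_mem_piecesR (Finset.mem_filter.1 i.2).1
  have hAhsub : ∀ i : d.ν, d.Ah i ⊆ AhOfR ends h u p ζ i.1.1 := by
    intro i
    obtain ⟨-, y, hy, hi⟩ := hPc i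
    rw [hi]; exact pieceC_subset hy
  have hFmem : ∀ k : d.κ, d.F k ∈ armsC ends h u ζ := fun k => (mem_farArmsR_iff.1 k.2).1
  -- the u-arm sets are not arms of dropped vertices, except the absorbed ones for their own arm
  have hUne : ∀ (j : d.ι) (r : ρ), DeadBlueR ends h u p ζ r → d.U j ≠ armC ends h u ζ (p r) := by
    rintro (⟨P, hP⟩ | ⟨x, hx⟩) r hr
    · exact (mem_uArmsR_iff.1 hP).2.1 r
    · obtain ⟨hx1, hx2⟩ := hAbs ⟨x, hx⟩
      rw [hx1]
      intro heq
      have hne : x.1 ≠ r := fun h' => hx2 (h' ▸ hr)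
      exact armP_ne_R hj hHU hne heq
  have hFne : ∀ (k : d.κ) (r : ρ), d.F k ≠ armC ends h u ζ (p r) :=
    fun k r => (mem_farArmsR_iff.1 k.2).2.1 r
  have hUF : ∀ (j : d.ι) (k : d.κ), d.U j ≠ d.F k := by
    rintro (⟨P, hP⟩ | ⟨x, hx⟩) k heq
    · have h1 := (mem_uArmsR_iff.1 hP).2.2
      rw [show P = d.F k from heq] at h1
      exact (mem_farArmsR_iff.1 k.2).2.2 h1
    · obtain ⟨hx1, -⟩ := hAbs ⟨x, hx⟩
      rw [hx1] at heq
      exact hFne k x.1 heq.symm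
  have hUU : ∀ j j' : d.ι, j ≠ j' → d.U j ≠ d.U j' := by
    rintro (⟨P, hP⟩ | ⟨x, hx⟩) (⟨P', hP'⟩ | ⟨x', hx'⟩) hne heq
    · exact hne (congrArg Sum.inl (Subtype.ext (show P = P' from heq)))
    · obtain ⟨hx1, -⟩ := hAbs ⟨x', hx'⟩
      exact (mem_uArmsR_iff.1 hP).2.1 x'.1 (by rw [← hx1]; exact heq)
    · obtain ⟨hx1, -⟩ := hAbs ⟨x, hx⟩
      exact (mem_uArmsR_iff.1 hP').2.1 x.1 (by rw [← hx1]; exact heq.symm)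
    · obtain ⟨hx1, -⟩ := hAbs ⟨x, hx⟩
      obtain ⟨hx1', -⟩ := hAbs ⟨x', hx'⟩
      have hrr : x.1 ≠ x'.1 := by
        intro h'
        apply hne
        have h2 : x.2 = x'.2 := by
          rw [(mem_absArmsR_iff.1 hx).2, (mem_absArmsR_iff.1 hx').2, h']
        exact congrArg Sum.inr (Subtype.ext (Prod.ext h' h2))
      rw [hx1, hx1'] at heq
      exact armP_ne_R hj hHU hrr heq
  -- the piece of `i` and a u-arm set are in distinct arms
  have hUAh : ∀ (j : d.ι) (i : d.ν), ∀ x, x ∈ d.U j → x ∉ d.Ah i := by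
    intro j i x hx hxi
    have hi := (hPc i).1
    exact armsC_disjoint (hUmem j) (hAP i.1.1) (hUne j i.1.1 hi) x hx (hAhsub i hxi).1
  have hAhF : ∀ (i : d.ν) (k : d.κ), ∀ x, x ∈ d.Ah i → x ∉ d.F k := by
    intro i k x hxi hxk
    exact armsC_disjoint (hAP i.1.1) (hFmem k) (fun h' => hFne k i.1.1 h'.symm) x
      (hAhsub i hxi).1 hxk
  have hAhAh : ∀ i i' : d.ν, i ≠ i' → ∀ x, x ∈ d.Ah i → x ∉ d.Ah i' := by
    intro i i' hne x hxi hxi'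
    obtain ⟨hi, y, hy, hiy⟩ := hPc i
    obtain ⟨hi', y', hy', hiy'⟩ := hPc i'
    by_cases hrr : i.1.1 = i'.1.1
    · -- same arm: two distinct pieces are disjoint
      have hne2 : d.Ah i ≠ d.Ah i' := by
        intro heq
        apply hne
        exact Subtype.ext (Prod.ext hrr (by show i.1.2 = i'.1.2; exact heq))
      rw [hiy] at hxi hne2
      rw [hiy'] at hxi' hne2
      have hy'' : y' ∈ AhOfR ends h u p ζ i.1.1 := by rw [hrr]; exact hy'
      have hxi'' : x ∈ pieceC ends h u p ζ i.1.1 y' := by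
        have : pieceC ends h u p ζ i'.1.1 y' = pieceC ends h u p ζ i.1.1 y' := by rw [hrr]
        rw [← this]; exact hxi'
      have hne3 : pieceC ends h u p ζ i.1.1 y ≠ pieceC ends h u p ζ i.1.1 y' := by
        intro heq
        apply hne2
        rw [heq]
        show pieceC ends h u p ζ i.1.1 y' = pieceC ends h u p ζ i'.1.1 y'
        rw [hrr]
      rcases pieceC_eq_or_disjoint (ends := ends) (h := h) (u := u) (p := p) (η := ζ)
        (r := i.1.1) (y := y) (y' := y') with heq | hdis
      · exact hne3 heq
      · exact hdis x hxi hxi''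
    · exact armsC_disjoint (hAP i.1.1) (hAP i'.1.1) (armP_ne_R hj hHU hrr) x
        (hAhsub i hxi).1 (hAhsub i' hxi').1
  -- a vertex of `H⁺ ∖ {h, u}` that is not a dropped vertex of a mixed arm lies in an arm set
  have hcover : ∀ x ∈ extHull ends ζ h u, x ≠ h → x ≠ u → (∀ r : d.ρ', x ≠ d.drop p r) →
      x ∈ armsAllR d.U d.Ah d.F := by
    intro x hxH hxh hxu hxp
    rcases arm_cases_R hj hxH hxh hxu with ⟨r, hx⟩ | ⟨r, hx⟩ | ⟨P, hP, hx⟩ | ⟨P, hP, hx⟩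
    · by_cases hr : DeadBlueR ends h u p ζ r
      · refine Or.inl (Or.inr (Set.mem_iUnion.2 ⟨⟨(r, pieceC ends h u p ζ r x), ?_⟩,
          mem_pieceC_self x⟩))
        exact Finset.mem_filter.2 ⟨mem_piecesR_of_mem_AhOfR' hr hx, mem_mixedR_iff.2 hr⟩
      · refine Or.inl (Or.inl (Set.mem_iUnion.2 ⟨Sum.inr ⟨(r, armC ends h u ζ (p r)), ?_⟩, hx.1⟩))
        exact mem_absArmsR_iff.2 ⟨hr, rfl⟩
    · by_cases hr : DeadBlueR ends h u p ζ r
      · exact absurd hx (hxp ⟨r, mem_mixedR_iff.2 hr⟩)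
      · refine Or.inl (Or.inl (Set.mem_iUnion.2 ⟨Sum.inr ⟨(r, armC ends h u ζ (p r)), ?_⟩, ?_⟩))
        · exact mem_absArmsR_iff.2 ⟨hr, rfl⟩
        · rw [hx]; exact hpP r
    · exact Or.inl (Or.inl (Set.mem_iUnion.2 ⟨Sum.inl ⟨P, hP⟩, hx⟩))
    · exact Or.inr (Set.mem_iUnion.2 ⟨⟨P, hP⟩, hx⟩)
  -- every arm set lies in the extended hull
  have hsubH : ∀ x, x ∈ armsAllR d.U d.Ah d.F → x ∈ extHull ends ζ h u ∧ x ≠ h ∧ x ≠ u := by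
    rintro x ((hx | hx) | hx)
    · obtain ⟨j, hj'⟩ := Set.mem_iUnion.1 hx
      exact armsC_subset (hUmem j) x hj'
    · obtain ⟨i, hi⟩ := Set.mem_iUnion.1 hx
      exact armsC_subset (hAP i.1.1) x (hAhsub i hi).1
    · obtain ⟨k, hk⟩ := Set.mem_iUnion.1 hx
      exact armsC_subset (hFmem k) x hk
  -- the dead edges of a mixed arm end in its own h-piece
  have hdeadArm : ∀ (r : d.ρ') (e : E) (x : V), ends e = s(p r.1, x) → (∃ i, x ∈ d.Ah i) →
      x ∈ AhOfR ends h u p ζ r.1 := by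
    rintro r e x hxe ⟨i, hxi⟩
    have hxA := hAhsub i hxi
    have hxH : x ∈ extHull ends ζ h u := (armsC_subset (hAP i.1.1) x hxA.1).1
    have hxh : x ≠ h := (armsC_subset (hAP i.1.1) x hxA.1).2.1
    have hxu : x ≠ u := (armsC_subset (hAP i.1.1) x hxA.1).2.2
    have hxarm : x ∈ armC ends h u ζ (p r.1) :=
      mem_armC_of_edge (hpP r.1) (hpH r.1) (hph r.1) (hpu r.1) hxH hxh hxu hxe
    have heq : armC ends h u ζ (p i.1.1) = armC ends h u ζ (p r.1) := by
      rw [← armC_eq_of_mem hxA.1, armC_eq_of_mem hxarm]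
    by_cases hrr : i.1.1 = r.1
    · rw [← hrr]; exact hxA
    · exact absurd heq (armP_ne_R hj hHU hrr)
  exact
  { hne_hu := hhu
    hne_hp := fun r => hj.hne_hp r.1
    hne_up := fun r => hj.hne_up r.1
    p_inj := fun r r' hrr => Subtype.ext (hj.p_inj hrr)
    h_notMem_U := fun j hh => (armsC_subset (hUmem j) h hh).2.1 rfl
    u_notMem_U := fun j hu => (armsC_subset (hUmem j) u hu).2.2 rfl
    p_notMem_U := fun r j hp =>
      armsC_disjoint (hUmem j) (hAP r.1) (hUne j r.1 (mem_mixedR_iff.1 r.2)) _ hp (hpP r.1)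
    h_notMem_Ah := fun i hh => (armsC_subset (hAP i.1.1) h (hAhsub i hh).1).2.1 rfl
    u_notMem_Ah := fun i hu => (armsC_subset (hAP i.1.1) u (hAhsub i hu).1).2.2 rfl
    p_notMem_Ah := fun r i hp => by
      have hpA := hAhsub i hp
      by_cases hrr : i.1.1 = r.1
      · rw [hrr] at hpA
        exact hpA.2 rfl
      · exact armsC_disjoint (hAP i.1.1) (hAP r.1) (armP_ne_R hj hHU hrr) _ hpA.1 (hpP r.1)
    h_notMem_F := fun k hh => (armsC_subset (hFmem k) h hh).2.1 rfl
    u_notMem_F := fun k hu => (armsC_subset (hFmem k) u hu).2.2 rfl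
    p_notMem_F := fun r k hp =>
      armsC_disjoint (hFmem k) (hAP r.1) (hFne k r.1) _ hp (hpP r.1)
    U_disj := fun j j' hne x hx => armsC_disjoint (hUmem j) (hUmem j') (hUU j j' hne) x hx
    U_disj_Ah := fun j i x hx => hUAh j i x hx
    U_disj_F := fun j k x hx => armsC_disjoint (hUmem j) (hFmem k) (hUF j k) x hx
    Ah_disj := fun i i' hne x hx => hAhAh i i' hne x hx
    Ah_disj_F := fun i k x hx => hAhF i k x hx
    F_disj := fun k k' hne x hx =>
      armsC_disjoint (hFmem k) (hFmem k') (fun h' => hne (Subtype.ext h')) x hx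
    U_nonempty := fun j => armsC_nonempty (hUmem j)
    Ah_nonempty := fun i => by
      obtain ⟨-, y, -, hiy⟩ := hPc i
      exact ⟨y, by rw [hiy]; exact mem_pieceC_self y⟩
    F_nonempty := fun k => armsC_nonempty (hFmem k)
    no_cross_UU := fun j j' hne e x y hxy hx hy =>
      armsC_no_cross (hUmem j) (hUmem j') (hUU j j' hne) hxy hx hy
    no_cross_UAh := fun j i e x y hxy hx hy =>
      armsC_no_cross (hUmem j) (hAP i.1.1) (hUne j i.1.1 (hPc i).1) hxy hx (hAhsub i hy).1
    no_cross_UF := fun j k e x y hxy hx hy =>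
      armsC_no_cross (hUmem j) (hFmem k) (hUF j k) hxy hx hy
    no_cross_AhAh := fun i i' hne e x y hxy hx hy => by
      obtain ⟨hi, y₁, hy₁, hiy⟩ := hPc i
      obtain ⟨hi', y₂, hy₂, hiy'⟩ := hPc i'
      by_cases hrr : i.1.1 = i'.1.1
      · have hne2 : d.Ah i ≠ d.Ah i' := by
          intro heq
          apply hne
          exact Subtype.ext (Prod.ext hrr (by show i.1.2 = i'.1.2; exact heq))
        rw [hiy] at hx hne2
        rw [hiy'] at hy hne2
        have hy₂' : y₂ ∈ AhOfR ends h u p ζ i.1.1 := by rw [hrr]; exact hy₂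
        have hy' : y ∈ pieceC ends h u p ζ i.1.1 y₂ := by
          have : pieceC ends h u p ζ i'.1.1 y₂ = pieceC ends h u p ζ i.1.1 y₂ := by rw [hrr]
          rw [← this]; exact hy
        have hne3 : pieceC ends h u p ζ i.1.1 y₁ ≠ pieceC ends h u p ζ i.1.1 y₂ := by
          intro heq
          apply hne2
          rw [heq]
          show pieceC ends h u p ζ i.1.1 y₂ = pieceC ends h u p ζ i'.1.1 y₂
          rw [hrr]
        exact pieceC_no_cross hy₁ hy₂' hne3 hxy hx hy'
      · exact armsC_no_cross (hAP i.1.1) (hAP i'.1.1) (armP_ne_R hj hHU hrr) hxy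
          (hAhsub i hx).1 (hAhsub i' hy).1
    no_cross_AhF := fun i k e x y hxy hx hy =>
      armsC_no_cross (hAP i.1.1) (hFmem k) (fun h' => hFne k i.1.1 h'.symm) hxy (hAhsub i hx).1 hy
    no_cross_FF := fun k k' hne e x y hxy hx hy =>
      armsC_no_cross (hFmem k) (hFmem k') (fun h' => hne (Subtype.ext h')) hxy hx hy
    h_edges := by
      intro e x hxe
      have hxh : x ≠ h := fun h' => hj.hloop_h e (by rw [hxe, h'])
      have hxu : x ≠ u := fun h' => hj.hnadj e (by rw [hxe, h'])
      have hxp : ∀ r : d.ρ', x ≠ d.drop p r := fun r h' => hj.hnadj_p r.1 e (by rw [hxe, h']; rfl)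
      have hxH : x ∈ extHull ends ζ h u := by
        cases he : ζ e with
        | true => exact Or.inl (Or.inl (mem_cluster_of_edge (mem_cluster_self _ _ _) he hxe))
        | false =>
          have he' : blue ζ e = true := by rw [blue_eq_true_iff]; exact he
          exact Or.inl (Or.inr (mem_cluster_of_edge (mem_cluster_self _ _ _) he' hxe))
      rcases hcover x hxH hxh hxu hxp with (hx | hx) | hx
      · obtain ⟨j, hj'⟩ := Set.mem_iUnion.1 hx
        exact Or.inl ⟨j, hj'⟩
      · obtain ⟨i, hi⟩ := Set.mem_iUnion.1 hx
        exact Or.inr (Or.inl ⟨i, hi⟩)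
      · obtain ⟨k, hk⟩ := Set.mem_iUnion.1 hx
        exact Or.inr (Or.inr ⟨k, hk⟩)
    u_edges := by
      intro e x hxe
      have hxu : x ≠ u := fun h' => hj.hloop_u e (by rw [hxe, h'])
      have hxh : x ≠ h := fun h' => hj.hnadj e (by rw [hxe, h', Sym2.eq_swap])
      by_cases hxp : ∃ r, x = p r
      · obtain ⟨r, rfl⟩ := hxp
        by_cases hr : DeadBlueR ends h u p ζ r
        · exact Or.inr ⟨⟨r, mem_mixedR_iff.2 hr⟩, rfl⟩
        · refine Or.inl ⟨Sum.inr ⟨(r, armC ends h u ζ (p r)), mem_absArmsR_iff.2 ⟨hr, rfl⟩⟩, ?_⟩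
          exact hpP r
      have hxH : x ∈ extHull ends ζ h u := by
        cases he : ζ e with
        | true => exact Or.inr (Or.inl (mem_cluster_of_edge (mem_cluster_self _ _ _) he hxe))
        | false =>
          have he' : blue ζ e = true := by rw [blue_eq_true_iff]; exact he
          exact Or.inr (Or.inr (mem_cluster_of_edge (mem_cluster_self _ _ _) he' hxe))
      obtain ⟨P, hP, hxP⟩ := exists_armsC_of_mem hhu hxH hxh hxu
      have hPp : ∀ r, P ≠ armC ends h u ζ (p r) := by
        intro r hPr
        rw [hPr] at hxP
        exact hxp ⟨r, eq_p_of_u_edge_R hj hHU r hxe hxP⟩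
      exact Or.inl ⟨Sum.inl ⟨P, mem_uArmsR_iff.2 ⟨hP, hPp, e, x, hxe, hxP⟩⟩, hxP⟩
    p_edges := by
      intro r e x hxe
      change ends e = s(p r.1, x) at hxe
      have hxp : x ≠ p r.1 := fun h' => hj.hloop_p r.1 e (by rw [hxe, h'])
      have hxh : x ≠ h := fun h' => hj.hnadj_p r.1 e (by rw [hxe, h', Sym2.eq_swap])
      by_cases hxu : x = u
      · exact Or.inl hxu
      by_cases hxH : x ∈ extHull ends ζ h u
      · have hxA : x ∈ AhOfR ends h u p ζ r.1 :=
          ⟨mem_armC_of_edge (hpP r.1) (hpH r.1) (hph r.1) (hpu r.1) hxH hxh hxu hxe, hxp⟩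
        have hmem : (r.1, pieceC ends h u p ζ r.1 x) ∈
            (piecesR ends h u p ζ).filter fun x => x.1 ∈ mixedR ends h u p ζ :=
          Finset.mem_filter.2 ⟨mem_piecesR_of_mem_AhOfR' (mem_mixedR_iff.1 r.2) hxA, r.2⟩
        exact Or.inr (Or.inl ⟨(⟨(r.1, pieceC ends h u p ζ r.1 x), hmem⟩ : d.ν), Subtype.ext rfl,
          mem_pieceC_self x⟩)
      · refine Or.inr (Or.inr ⟨hxh, fun r' h' => hxH (h' ▸ hpH r'.1), fun hx => hxH (hsubH x hx).1⟩)
    u_adj_U := by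
      rintro (⟨P, hP⟩ | ⟨x, hx⟩)
      · exact (mem_uArmsR_iff.1 hP).2.2
      · obtain ⟨hx1, -⟩ := hAbs ⟨x, hx⟩
        obtain ⟨e, he⟩ := hj.hup x.1
        exact ⟨e, p x.1, he, by rw [hx1]; exact hpP x.1⟩
    h_red := by
      intro e x hxe
      have hxh : x ≠ h := fun h' => hj.hloop_h e (by rw [hxe, h'])
      have hxu : x ≠ u := fun h' => hj.hnadj e (by rw [hxe, h'])
      cases he : ζ e with
      | true =>
        have hxR : x ∈ redExt ends h u ζ := by
          rw [mem_redExt_iff]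
          exact ⟨Or.inl (mem_cluster_of_edge (mem_cluster_self _ _ _) he hxe), hxh, hxu⟩
        rw [coreBaseOf_apply_of_notMem hxe h_notMem_blueExt (fun h' => hdisj x hxR h'), he]
      | false =>
        have he' : blue ζ e = true := by rw [blue_eq_true_iff]; exact he
        have hxB : x ∈ blueExt ends ζ h u := by
          rw [mem_blueExt_iff]
          exact ⟨Or.inl (mem_cluster_of_edge (mem_cluster_self _ _ _) he' hxe), hxh, hxu⟩
        rw [coreBaseOf_apply_of_mem (ends_swap hxe) hxB, he]
        rfl
    u_red := by
      intro e x hxe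
      have hxu : x ≠ u := fun h' => hj.hloop_u e (by rw [hxe, h'])
      have hxh : x ≠ h := fun h' => hj.hnadj e (by rw [hxe, h', Sym2.eq_swap])
      cases he : ζ e with
      | true =>
        have hxR : x ∈ redExt ends h u ζ := by
          rw [mem_redExt_iff]
          exact ⟨Or.inr (mem_cluster_of_edge (mem_cluster_self _ _ _) he hxe), hxh, hxu⟩
        rw [coreBaseOf_apply_of_notMem hxe u_notMem_blueExt (fun h' => hdisj x hxR h'), he]
      | false =>
        have he' : blue ζ e = true := by rw [blue_eq_true_iff]; exact he
        have hxB : x ∈ blueExt ends ζ h u := by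
          rw [mem_blueExt_iff]
          exact ⟨Or.inr (mem_cluster_of_edge (mem_cluster_self _ _ _) he' hxe), hxh, hxu⟩
        rw [coreBaseOf_apply_of_mem (ends_swap hxe) hxB, he]
        rfl
    dead_blue := fun r e x hxe hx => (mem_mixedR_iff.1 r.2) e x hxe (hdeadArm r e x hxe hx)
    ext_blue := by
      intro r e x hxe hxu hxA
      change ends e = s(p r.1, x) at hxe
      have hxp : x ≠ p r.1 := fun h' => hj.hloop_p r.1 e (by rw [hxe, h'])
      have hxh : x ≠ h := fun h' => hj.hnadj_p r.1 e (by rw [hxe, h', Sym2.eq_swap])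
      have hxH : x ∉ extHull ends ζ h u := by
        intro hxH
        have hxA' : x ∈ AhOfR ends h u p ζ r.1 :=
          ⟨mem_armC_of_edge (hpP r.1) (hpH r.1) (hph r.1) (hpu r.1) hxH hxh hxu hxe, hxp⟩
        have hmem : (r.1, pieceC ends h u p ζ r.1 x) ∈
            (piecesR ends h u p ζ).filter fun x => x.1 ∈ mixedR ends h u p ζ :=
          Finset.mem_filter.2 ⟨mem_piecesR_of_mem_AhOfR' (mem_mixedR_iff.1 r.2) hxA', r.2⟩
        exact hxA (⟨(r.1, pieceC ends h u p ζ r.1 x), hmem⟩ : d.ν) (mem_pieceC_self x)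
      exact coreBaseOf_bdry_blue hdisj hxe (hpH r.1) hxH
    bdry_blue := by
      intro e x y hxy hx hyh hyu hyp hy
      have hxH := (hsubH x hx).1
      have hyH : y ∉ extHull ends ζ h u := fun hyH => hy (hcover y hyH hyh hyu hyp)
      exact coreBaseOf_bdry_blue hdisj hxy hxH hyH
    U_conn := dataU_conn hj hl hζ hk
    Ah_conn := dataAh_conn hj hl hζ hk
    F_conn := dataF_conn hj hl hζ hk }

end Base

end MixedArms

end Summit.Ventures.PercRepro2
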